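import Literature.Geometry.Lorentzian.SpacetimeChartDeviationTransfer
import HarnessLib

/-!
# Lemmas for the diagonal ("limits of limits") of pointed `Cᵏ_loc` convergence of spacetimes
(topic `Geometry/Lorentzian`; preparatory results for `LocalSubconvergence.trans`: if the
translates `(𝓢, qₙ)` of a spacetime subconverge to `(𝓣, t)` and the translates `(𝓣, q'ₘ)`
subconverge to `(𝓤, u)`, then suitable translates of `𝓢` subconverge to `(𝓤, u)` — Petersen 2006,
Ch. 10, §3.2; Hale 1980, Ch. I §8, Thm. 8.1 (limit sets are closed and invariant))

Contents:

* `exists_strictMono_step` — recursive extraction: from `∀ i, ∀ᶠ j, P i j` a strictly increasing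
  `ρ` with `P (ρ m) (ρ (m+1))` and prescribed lower bound `ρ 0 ≥ m₀` (used to sparsify the
  exhaustion so that `closure (U (ρ m)) ⊆ U (ρ (m + 1))` and similar step conditions hold).
* `isLocalDiffeomorphOn_comp`, composite comparison maps.
* `exists_finset_chartBalls` — REFERENCE BALLS: a compact `C` inside an open `O ⊆ 𝓤` is covered
  by finitely many open chart balls `c_p⁻¹(ball (c_p p) (r p))` whose closed versions are compact
  chart pieces `closedBall (c_p p) (r p) ⊆ c_p.target` with `c_p⁻¹(closedBall) ⊆ O`.
* `LocalSubconvergence.tendsto_supCkENorm_comp_sub` — FIRST-BRACKET CONVERGENCE: for a datum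
  `D : (𝓢ₙ, pₙ) ⇀ (𝓣, t)` and a FIXED map `F : 𝓤 → 𝓣`, `C^∞` on an open `W`, the `Cᵏ` sup norm
  over any compact chart piece `K` of `𝓤` (with `c_p⁻¹ K ⊆ W`) of
  `(φₙ ∘ F ∘ c_p⁻¹)^* gₙ − (F ∘ c_p⁻¹)^* g_𝓣` tends to `0` — the deviation of the composite
  `φₙ ∘ F` from the middle space, cut into finitely many pieces each read in one chart of `𝓣`
  (`metricInCoords_comp_comp_sub_metricInCoords_comp_eq`, `tendsto_supCkENorm_bilinPullback`).

## References
* [Petersen2006] P. Petersen, *Riemannian Geometry*, 2nd ed., GTM 171, Springer 2006, Ch. 10, §3.2.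
* [Hale1980] J. K. Hale, *Ordinary Differential Equations*, 2nd ed., Krieger 1980, Ch. I §8.
-/

noncomputable section

open TopologicalSpace Manifold Filter Topology Set Function Metric Bundle
open scoped ContDiff Topology ENNReal

universe u v w

namespace Literature.Geometry.Lorentzian

/-! ### Recursive extraction -/

section Extraction

/-- **Recursive extraction along `atTop`.** If for every `i` the property `P i j` holds for all
large `j`, there is a strictly increasing sequence `ρ` with `ρ 0 ≥ m₀` along which every step
satisfies `P (ρ m) (ρ (m + 1))` (define `ρ (m+1) = max (N (ρ m)) (ρ m + 1)` for thresholds `N`).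
[folklore] -/
theorem exists_strictMono_step {P : ℕ → ℕ → Prop} (h : ∀ i, ∀ᶠ j in atTop, P i j) (m₀ : ℕ) :
    ∃ ρ : ℕ → ℕ, StrictMono ρ ∧ m₀ ≤ ρ 0 ∧ ∀ m, P (ρ m) (ρ (m + 1)) := by
  have hN : ∀ i, ∃ N, ∀ j, N ≤ j → P i j := fun i ↦ eventually_atTop.1 (h i)
  choose N hN using hN
  let ρ : ℕ → ℕ := fun m ↦ Nat.rec m₀ (fun _ r ↦ max (N r) (r + 1)) m
  have hρs : ∀ m, ρ (m + 1) = max (N (ρ m)) (ρ m + 1) := fun m ↦ rfl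
  refine ⟨ρ, strictMono_nat_of_lt_succ fun m ↦ ?_, le_rfl, fun m ↦ ?_⟩
  · rw [hρs]
    exact Nat.lt_succ_self _ |>.trans_le (le_max_right _ _)
  · rw [hρs]
    exact hN _ _ (le_max_left _ _)

end Extraction

/-! ### Composite comparison maps -/

section Composite

variable {E H : Type*} [NormedAddCommGroup E] [NormedSpace ℝ E] [TopologicalSpace H]
  {I : ModelWithCorners ℝ E H} {M N P : Type*} [TopologicalSpace M] [ChartedSpace H M]
  [TopologicalSpace N] [ChartedSpace H N] [TopologicalSpace P] [ChartedSpace H P] {n : ℕ∞ω}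

/-- A composite of local diffeomorphisms on sets is a local diffeomorphism on the first set, given
that it is mapped into the second (Mathlib `IsLocalDiffeomorphAt.comp`, pointwise). [folklore] -/
theorem isLocalDiffeomorphOn_comp {g : N → P} {f : M → N} {s : Set M} {t : Set N}
    (hg : IsLocalDiffeomorphOn I I n g t) (hf : IsLocalDiffeomorphOn I I n f s)
    (hst : MapsTo f s t) : IsLocalDiffeomorphOn I I n (g ∘ f) s :=
  fun x ↦ (hf x).comp (K := I) (P := P) (hg ⟨f x, hst x.2⟩)

end Composite

namespace Spacetime

/-! ### Reference chart balls -/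

section ChartBalls

variable (𝓤 : Spacetime.{w} 4)

/-- **Reference chart balls.** A compact set `C` contained in an open set `O` of a spacetime is
covered by finitely many open chart balls `c_p.source ∩ c_p⁻¹(ball (c_p p) (r p))`, `p` in a finite
set, `c_p = chartAt E4 p`, with `0 < r p`, `closedBall (c_p p) (r p) ⊆ c_p.target` and
`c_p⁻¹(closedBall (c_p p) (r p)) ⊆ O` (charts are local homeomorphisms onto open subsets of `E4`;
compactness). [folklore] -/
theorem exists_finset_chartBalls {O : Set 𝓤.carrier} (hO : IsOpen O) {C : Set 𝓤.carrier}
    (hC : IsCompact C) (hCO : C ⊆ O) :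
    ∃ (S : Finset 𝓤.carrier) (r : 𝓤.carrier → ℝ),
      (∀ p ∈ S, 0 < r p ∧ closedBall (chartAt E4 p p) (r p) ⊆ (chartAt E4 p).target ∧
        (chartAt E4 p).symm '' closedBall (chartAt E4 p p) (r p) ⊆ O) ∧
      C ⊆ ⋃ p ∈ S, (chartAt E4 p).source ∩ chartAt E4 p ⁻¹' ball (chartAt E4 p p) (r p) := by
  classical
  have hrad : ∀ p ∈ C, ∃ r : ℝ, 0 < r ∧ closedBall (chartAt E4 p p) r ⊆
      (chartAt E4 p).target ∩ (chartAt E4 p).symm ⁻¹' O := by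
    intro p hp
    have hopen : IsOpen ((chartAt E4 p).target ∩ (chartAt E4 p).symm ⁻¹' O) :=
      (chartAt E4 p).continuousOn_symm.isOpen_inter_preimage (chartAt E4 p).open_target hO
    have hmem : chartAt E4 p p ∈ (chartAt E4 p).target ∩ (chartAt E4 p).symm ⁻¹' O :=
      ⟨mem_chart_target E4 p, by
        rw [mem_preimage, (chartAt E4 p).left_inv (mem_chart_source E4 p)]
        exact hCO hp⟩
    obtain ⟨r, hr, hrO⟩ := Metric.nhds_basis_closedBall.mem_iff.1 (hopen.mem_nhds hmem)
    exact ⟨r, hr, hrO⟩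
  choose! r hr hrO using hrad
  have hW : ∀ p ∈ C, (chartAt E4 p).source ∩ chartAt E4 p ⁻¹' ball (chartAt E4 p p) (r p) ∈
      𝓝 p := fun p hp ↦
    ((chartAt E4 p).continuousOn.isOpen_inter_preimage (chartAt E4 p).open_source
      isOpen_ball).mem_nhds ⟨mem_chart_source E4 p, mem_ball_self (hr p hp)⟩
  obtain ⟨S, hS⟩ := hC.elim_nhds_subcover' (fun p _ ↦
    (chartAt E4 p).source ∩ chartAt E4 p ⁻¹' ball (chartAt E4 p p) (r p)) hW
  refine ⟨S.image Subtype.val, r, fun p hp ↦ ?_, fun q hq ↦ ?_⟩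
  · obtain ⟨p', hp', rfl⟩ := Finset.mem_image.1 hp
    refine ⟨hr _ p'.2, (hrO _ p'.2).trans inter_subset_left, ?_⟩
    rintro _ ⟨y, hy, rfl⟩
    exact (hrO _ p'.2 hy).2
  · obtain ⟨p', hp', hq'⟩ := mem_iUnion₂.1 (hS hq)
    exact mem_iUnion₂.2 ⟨(p' : 𝓤.carrier), Finset.mem_image_of_mem _ hp', hq'⟩

end ChartBalls

/-! ### First-bracket convergence for a fixed intermediate map -/

namespace LocalSubconvergence

variable {𝓢ₙ : ℕ → Spacetime.{u} 4} {pₙ : ∀ n, (𝓢ₙ n).carrier} {𝓣 : Spacetime.{v} 4}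
  {t : 𝓣.carrier} {k : ℕ} {𝓤 : Spacetime.{w} 4}

/-- **First-bracket convergence.** Let `D` be a subconvergence datum `(𝓢ₙ, pₙ) ⇀ (𝓣, t)` with
comparison maps `φₙ`, let `F : 𝓤 → 𝓣` be `C^∞` on an open set `W`, and let `K` be a compact subset
of the target of the chart `c_p` of `𝓤` at `p` with `c_p⁻¹(K) ⊆ W`. Then the `Cᵏ` sup norm over
`K` of `(φₙ ∘ F ∘ c_p⁻¹)^* gₙ − (F ∘ c_p⁻¹)^* g_𝓣` — the deviation of the composite `φₙ ∘ F` from the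
middle space `𝓣`, read in the chart of `𝓤` — tends to `0`: cut `K` into finitely many compact
pieces each mapped by `F ∘ c_p⁻¹` into one chart ball of `𝓣`, rewrite the deviation there as the
transported deviation of `φₙ` (`metricInCoords_comp_comp_sub_metricInCoords_comp_eq`) and use the
continuity of transport for `Cᵏ_loc` convergence to zero (`tendsto_supCkENorm_bilinPullback`).
Petersen 2006, Ch. 10, §3.2. [cite: Petersen2006, Ch. 10 §3.2] -/
theorem tendsto_supCkENorm_comp_sub (D : LocalSubconvergence 𝓢ₙ pₙ 𝓣 t k)
    {F : 𝓤.carrier → 𝓣.carrier} {W : Set 𝓤.carrier} (hW : IsOpen W)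
    (hF : ContMDiffOn (𝓡 4) (𝓡 4) ∞ F W) (p : 𝓤.carrier) {K : Set E4} (hK : IsCompact K)
    (hKt : K ⊆ (chartAt E4 p).target) (hKW : MapsTo (chartAt E4 p).symm K W) :
    Tendsto (fun n ↦ supCkENorm K k
      ((𝓢ₙ (D.sub n)).metricInCoords ((D.embed n ∘ F) ∘ (chartAt E4 p).symm) -
        𝓣.metricInCoords (F ∘ (chartAt E4 p).symm))) atTop (𝓝 0) := by
  classical
  set c := chartAt E4 p with hc
  -- chart balls of `𝓣`
  have hrad : ∀ x' : 𝓣.carrier, ∃ r : ℝ, 0 < r ∧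
      closedBall (chartAt E4 x' x') r ⊆ (chartAt E4 x').target := fun x' ↦
    Metric.nhds_basis_closedBall.mem_iff.1
      ((chartAt E4 x').open_target.mem_nhds (mem_chart_target E4 x'))
  choose r hr hrt using hrad
  -- the open sets `O x' ⊆ E4`
  set O : 𝓣.carrier → Set E4 := fun x' ↦ c.target ∩ c.symm ⁻¹' (W ∩ F ⁻¹'
    ((chartAt E4 x').source ∩ chartAt E4 x' ⁻¹' ball (chartAt E4 x' x') (r x'))) with hO
  have hOo : ∀ x', IsOpen (O x') := fun x' ↦
    c.continuousOn_symm.isOpen_inter_preimage c.open_target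
      (hF.continuousOn.isOpen_inter_preimage hW
        ((chartAt E4 x').continuousOn.isOpen_inter_preimage (chartAt E4 x').open_source
          isOpen_ball))
  have hKO : K ⊆ ⋃ x', O x' := fun y hy ↦ mem_iUnion.2 ⟨F (c.symm y), hKt hy, hKW hy,
    mem_chart_source E4 _, mem_ball_self (hr _)⟩
  obtain ⟨S, ε, hSO, hKS⟩ := exists_finset_closedBall_pieces_of_isCompact hK O hOo hKO
  set P : E4 → Set E4 := fun y ↦ K ∩ closedBall y (ε y) with hP
  have hPc : ∀ y, IsCompact (P y) := fun y ↦ hK.inter_right isClosed_closedBall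
  have hPK : ∀ y, P y ⊆ K := fun y ↦ inter_subset_left
  -- the field whose sup norms we estimate
  set Φ : ℕ → E4 → E4 →L[ℝ] E4 →L[ℝ] ℝ := fun n ↦
    (𝓢ₙ (D.sub n)).metricInCoords ((D.embed n ∘ F) ∘ c.symm) - 𝓣.metricInCoords (F ∘ c.symm)
    with hΦ
  -- estimate on each piece
  have hpiece : ∀ y ∈ S, Tendsto (fun n ↦ supCkENorm (P y) k (Φ n)) atTop (𝓝 0) := by
    intro y hy
    obtain ⟨x', hPO⟩ := hSO y hy
    set c' := chartAt E4 x' with hc'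
    set θ : E4 → E4 := chartTransition F p x' with hθ
    set s : Set E4 := transitionDomain F W p x' with hs
    have hso : IsOpen s := isOpen_transitionDomain hW hF.continuousOn p x'
    have hθs : ContDiffOn ℝ ∞ θ s := contDiffOn_chartTransition hF p x'
    have hPs : P y ⊆ s := fun y' hy' ↦ by
      have h := hPO hy'
      exact mem_transitionDomain.2 ⟨h.1, h.2.1, h.2.2.1⟩
    have hθP : MapsTo θ (P y) (closedBall (c' x') (r x')) := fun y' hy' ↦
      ball_subset_closedBall (hPO hy').2.2.2
    -- smoothness of the deviations of `D` near the closed ball, eventually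
    have hB : ∀ᶠ n in atTop, ∃ t' : Set E4, IsOpen t' ∧ closedBall (c' x') (r x') ⊆ t' ∧
        ContDiffOn ℝ k (D.coordDeviation n x') t' := by
      have hC : IsCompact (c'.symm '' closedBall (c' x') (r x')) :=
        (isCompact_closedBall _ _).image_of_continuousOn (c'.continuousOn_symm.mono (hrt x'))
      filter_upwards [D.eventually_subset_U hC] with n hn
      refine ⟨c'.target ∩ c'.symm ⁻¹' (D.U n : Set 𝓣.carrier),
        c'.continuousOn_symm.isOpen_inter_preimage c'.open_target (D.U n).isOpen,
        fun y' hy' ↦ ⟨hrt x' hy', hn (mem_image_of_mem _ hy')⟩, ?_⟩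
      rw [D.coordDeviation_eq_chartDeviation]
      exact (contDiffOn_chartDeviation _ (D.U n).isOpen (D.contMDiffOn_embed n) x').of_le
        (by exact_mod_cast le_top)
    have hlim := tendsto_supCkENorm_bilinPullback hso
      ((hθs.of_le (by exact_mod_cast le_top)) : ContDiffOn ℝ (k + 1) θ s) (hPc y) hPs hθP hB
      (D.tendsto_supCkENorm_coordDeviation x' (isCompact_closedBall _ _) (hrt x'))
    -- the germ identity on the piece, eventually
    have hgerm : ∀ᶠ n in atTop, ∀ y' ∈ P y,
        Φ n =ᶠ[𝓝 y'] bilinPullback θ (D.coordDeviation n x') := by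
      have hC : IsCompact (F '' (c.symm '' K)) :=
        (hK.image_of_continuousOn (c.continuousOn_symm.mono hKt)).image_of_continuousOn
          (hF.continuousOn.mono fun _ ⟨y', hy', hq⟩ ↦ hq ▸ hKW hy')
      filter_upwards [D.eventually_subset_U hC] with n hn y' hy'
      -- the open set on which the pointwise identity holds
      set s' : Set E4 := c.target ∩ c.symm ⁻¹' (W ∩ F ⁻¹' ((chartAt E4 x').source ∩
        (D.U n : Set 𝓣.carrier))) with hs'
      have hs'o : IsOpen s' :=
        c.continuousOn_symm.isOpen_inter_preimage c.open_target
          (hF.continuousOn.isOpen_inter_preimage hW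
            ((chartAt E4 x').open_source.inter (D.U n).isOpen))
      have hy's' : y' ∈ s' := by
        have h := hPO hy'
        exact ⟨h.1, h.2.1, h.2.2.1, hn (mem_image_of_mem _ (mem_image_of_mem _ (hPK y hy')))⟩
      filter_upwards [hs'o.mem_nhds hy's'] with y'' hy''
      obtain ⟨h1, h2, h3, h4⟩ := hy''
      have hFd : MDifferentiableAt (𝓡 4) (𝓡 4) F (c.symm y'') :=
        ((hF _ h2).contMDiffAt (hW.mem_nhds h2)).mdifferentiableAt (by simp)
      have hGd : MDifferentiableAt (𝓡 4) (𝓡 4) (D.embed n) (F (c.symm y'')) :=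
        ((D.contMDiffOn_embed n _ h4).contMDiffAt ((D.U n).isOpen.mem_nhds h4)).mdifferentiableAt
          (by simp)
      have key := metricInCoords_comp_comp_sub_metricInCoords_comp_eq (𝓢 := 𝓢ₙ (D.sub n))
        (G := D.embed n) (F := F) (x := p) (x' := x') h1 hFd h3 hGd
      exact key
    refine (tendsto_congr' ?_).2 hlim
    filter_upwards [hgerm] with n hn
    exact supCkENorm_congr hn
  -- assemble the pieces
  have hsum : Tendsto (fun n ↦ ∑ y ∈ S, supCkENorm (P y) k (Φ n)) atTop (𝓝 0) := by
    have h := tendsto_finsetSum S fun y hy ↦ hpiece y hy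
    simpa using h
  refine tendsto_of_tendsto_of_tendsto_of_le_of_le tendsto_const_nhds hsum (fun _ ↦ zero_le)
    fun n ↦ ?_
  exact (supCkENorm_mono hKS k _).trans (supCkENorm_biUnion_finset_le S P k _)

end LocalSubconvergence

end Spacetime

end Literature.Geometry.Lorentzian
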